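import Summits.SmoothPoincare4.SmoothPoincare4.Theses.EntropyRung
import Literature.Geometry.Riemannian.InjectivityRadius
import Summits.SmoothPoincare4.SmoothPoincare4.Theorems.SubcylindricalExistence.Negative.Window

/-!
# Sketch — crux idea `injectivity-window-green-berger` for `EntropyRung.SubcylindricalExistence`
(stmt-SmoothPoincare4-10871; crux-ideate round 1, ideator 2, gen 2)

First lemmas of the line, as `Prop`s over the route's fact-free vocabulary
(`PseudoRiemannianMetric`, `g.scalarCurvature`, `g.gradSq`, `riemannianMeasure`) plus the tree's
`Literature.Geometry.Riemannian.globalInjectivityRadius` (InjectivityRadius.lean, Lee p.165).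

* `TopWindow ε α`        — PROVABLE NOW (calculus + the LSI hypothesis): volume ≥ 8π²/3, R ≥ 12(1−ε) and a
                            log-Sobolev constant α for dV/V give the crux's entropy clause at level
                            ν_rd + 2 log(1−ε) for every τ ≥ 1/(2α) (constants are optimal there).
* `BergerIsoembolicFour`  — named-fact shape (Berger 1980): inj ≥ π ⇒ Vol ≥ Vol(S⁴(1)) = 8π²/3.
* `GreenScalarBound`      — named-fact shape (L. W. Green 1963): inj ≥ π ⇒ ∫ R dV ≤ 12·Vol (= iff round).
* `SubinjectivityBound ε η δ` — the Σ-blind CONJECTURE [B] of the card: in the class {inj ≥ π, R ≥ 12(1−ε)}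
                            the crux's clause holds at level ν_cyl + δ for all τ ≤ (1+η)/8.
* `AlmostWiedersehenExistence ε η` — the transfer target [A] = C⁺(Σ).
* `InjectivityWindowReduction` — the composition [B] ∧ [A] ⇒ SubcylindricalExistence (statement).
-/

noncomputable section

open scoped Manifold ContDiff ENNReal ContinuousMap
open MeasureTheory Set Literature.Geometry.Lorentzian Literature.Geometry.Riemannian
open Summit.SmoothPoincare4.SmoothPoincare4.Theses.EntropyRung

namespace Summit.SmoothPoincare4.SmoothPoincare4.Cruxes.SubcylindricalExistence.InjectivityWindow

/-- The crux's unfolded entropy clause "`c ≤ 𝒲(g,f,τ)` for all admissible `f`" at ONE scale `τ`. -/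
def ClauseAt (M : Type) [TopologicalSpace M] [T2Space M] [SecondCountableTopology M]
    [ChartedSpace (EuclideanSpace ℝ (Fin 4)) M] [IsManifold (𝓡 4) ∞ M] [T3Space M] [MeasurableSpace M]
    [BorelSpace M]
    (g : PseudoRiemannianMetric (𝓡 4) ∞ (EuclideanSpace ℝ (Fin 4)) (TangentSpace (𝓡 4) : M → Type _))
    [g.HasLeviCivita] (hg : g.IsRiemannian) (c τ : ℝ) : Prop :=
  ∀ f : M → ℝ, ContMDiff (𝓡 4) 𝓘(ℝ, ℝ) ∞ f →
    ∫ x, (4 * Real.pi * τ) ^ (-(4 : ℝ) / 2) * Real.exp (-f x)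
        ∂(riemannianMeasure (g.toContMDiffRiemannianMetric hg)) = 1 →
    c ≤ ∫ x, (τ * (g.scalarCurvature x + g.gradSq f x) + f x - 4) *
        ((4 * Real.pi * τ) ^ (-(4 : ℝ) / 2) * Real.exp (-f x))
        ∂(riemannianMeasure (g.toContMDiffRiemannianMetric hg))

/-- Log-Sobolev inequality with constant `α` for the NORMALISED volume `dV/V`, written against `dV`:
for smooth `w` with `∫ w² dV = 1`, `∫ w² log w² dV + log V ≤ (2/α) ∫ |∇w|² dV`.  On `S⁴(1)`: `α = 4`
(Mueller–Weissler), which is why constants optimise `𝒲` exactly for `τ ≥ 1/8`. -/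
def LSI (M : Type) [TopologicalSpace M] [T2Space M] [SecondCountableTopology M]
    [ChartedSpace (EuclideanSpace ℝ (Fin 4)) M] [IsManifold (𝓡 4) ∞ M] [T3Space M] [MeasurableSpace M]
    [BorelSpace M]
    (g : PseudoRiemannianMetric (𝓡 4) ∞ (EuclideanSpace ℝ (Fin 4)) (TangentSpace (𝓡 4) : M → Type _))
    [g.HasLeviCivita] (hg : g.IsRiemannian) (α : ℝ) : Prop :=
  ∀ w : M → ℝ, ContMDiff (𝓡 4) 𝓘(ℝ, ℝ) ∞ w →
    ∫ x, w x ^ 2 ∂(riemannianMeasure (g.toContMDiffRiemannianMetric hg)) = 1 →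
    ∫ x, w x ^ 2 * Real.log (w x ^ 2) ∂(riemannianMeasure (g.toContMDiffRiemannianMetric hg))
      + Real.log ((riemannianMeasure (g.toContMDiffRiemannianMetric hg) univ).toReal)
      ≤ 2 / α * ∫ x, g.gradSq w x ∂(riemannianMeasure (g.toContMDiffRiemannianMetric hg))

/-- **TopWindow** (first lemma, provable now). For a closed connected smooth 4-manifold with a Riemannian
metric: `Vol ≥ 8π²/3`, `R ≥ 12(1−ε)` pointwise and `LSI α` give, for every `τ ≥ 1/(2α)`,
`𝒲(g,f,τ) ≥ τ·12(1−ε) + log Vol − 2 log(4πτ) − 4 ≥ (log 6 − 2) + 2 log(1−ε)` — i.e. the crux's clause at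
level `ν_rd + 2 log(1−ε)`, which is `> ν_cyl` iff `ε < 1 − (πe/9)^{1/4} ≈ 0.01304`. -/
def TopWindow (ε α : ℝ) : Prop :=
  ∀ (M : Type) [TopologicalSpace M] [T2Space M] [SecondCountableTopology M]
    [ChartedSpace (EuclideanSpace ℝ (Fin 4)) M] [IsManifold (𝓡 4) ∞ M] [CompactSpace M] [ConnectedSpace M]
    [T3Space M] [MeasurableSpace M] [BorelSpace M]
    (g : PseudoRiemannianMetric (𝓡 4) ∞ (EuclideanSpace ℝ (Fin 4)) (TangentSpace (𝓡 4) : M → Type _))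
    [g.HasLeviCivita] (hg : g.IsRiemannian),
    ENNReal.ofReal (8 * Real.pi ^ 2 / 3) ≤ riemannianMeasure (g.toContMDiffRiemannianMetric hg) univ →
    (∀ x : M, 12 * (1 - ε) ≤ g.scalarCurvature x) →
    LSI M g hg α →
    ∀ τ : ℝ, 1 / (2 * α) ≤ τ → ClauseAt M g hg (Real.log 6 - 2 + 2 * Real.log (1 - ε)) τ

/-- **Berger's isoembolic inequality, dimension 4, at `inj ≥ π`** (Berger 1980, Ann. Inst. Fourier 30;
Berger, *A Panoramic View*, Thm 148: `Vol(M) ≥ σ(d) (inj/π)^d`, equality only for round spheres):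
a closed Riemannian 4-manifold with `inj(M,g) ≥ π` has `Vol ≥ Vol(S⁴(1)) = 8π²/3`. Named-fact shape. -/
def BergerIsoembolicFour : Prop :=
  ∀ (M : Type) [TopologicalSpace M] [T2Space M] [SecondCountableTopology M]
    [ChartedSpace (EuclideanSpace ℝ (Fin 4)) M] [IsManifold (𝓡 4) ∞ M] [CompactSpace M] [ConnectedSpace M]
    [T3Space M] [MeasurableSpace M] [BorelSpace M]
    (g : PseudoRiemannianMetric (𝓡 4) ∞ (EuclideanSpace ℝ (Fin 4)) (TangentSpace (𝓡 4) : M → Type _))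
    [g.HasLeviCivita] (hg : g.IsRiemannian),
    ENNReal.ofReal Real.pi ≤ globalInjectivityRadius g →
    ENNReal.ofReal (8 * Real.pi ^ 2 / 3) ≤ riemannianMeasure (g.toContMDiffRiemannianMetric hg) univ

/-- **Green's scalar-curvature bound** (L. W. Green 1963, *Auf Wiedersehensflächen*, Ann. Math. 78: if the
first conjugate point along every geodesic is at distance `≥ π` — in particular if `inj ≥ π` — then
`∫ scal dV ≤ n(n−1) Vol`, with equality iff constant curvature `1`; mechanism: integrate the index form of
`sin t · E(t)` over the unit tangent bundle, Berger *Panoramic View* PDF p.421). Dimension 4, inequality part. -/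
def GreenScalarBound : Prop :=
  ∀ (M : Type) [TopologicalSpace M] [T2Space M] [SecondCountableTopology M]
    [ChartedSpace (EuclideanSpace ℝ (Fin 4)) M] [IsManifold (𝓡 4) ∞ M] [CompactSpace M] [ConnectedSpace M]
    [T3Space M] [MeasurableSpace M] [BorelSpace M]
    (g : PseudoRiemannianMetric (𝓡 4) ∞ (EuclideanSpace ℝ (Fin 4)) (TangentSpace (𝓡 4) : M → Type _))
    [g.HasLeviCivita] (hg : g.IsRiemannian),
    ENNReal.ofReal Real.pi ≤ globalInjectivityRadius g →
    ∫ x, g.scalarCurvature x ∂(riemannianMeasure (g.toContMDiffRiemannianMetric hg))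
      ≤ 12 * (riemannianMeasure (g.toContMDiffRiemannianMetric hg) univ).toReal

/-- **[B] Sub-injectivity entropy bound (CONJECTURE, Σ-blind).** In the class of closed Riemannian
4-manifolds with `inj ≥ π` and `R ≥ 12(1−ε)` (an "almost-Wiedersehen" class: by Green `⨍R ≤ 12`), Perelman's
`𝒲` at every scale `τ ≤ (1+η)/8` is at least `ν_cyl + δ`.  Evidence: `S⁴(1)` itself has
`μ(S⁴,1/8) = −0.1329` (margin `0.10`) and global minimum `ν_rd = −0.2082` at `τ = 1/6`; after inj-normalisation
necks, bubble sheets, `ℂP²`, `S²×S²` are all excluded from the class (`R` too small). -/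
def SubinjectivityBound (ε η δ : ℝ) : Prop :=
  ∀ (M : Type) [TopologicalSpace M] [T2Space M] [SecondCountableTopology M]
    [ChartedSpace (EuclideanSpace ℝ (Fin 4)) M] [IsManifold (𝓡 4) ∞ M] [CompactSpace M] [ConnectedSpace M]
    [T3Space M] [MeasurableSpace M] [BorelSpace M]
    (g : PseudoRiemannianMetric (𝓡 4) ∞ (EuclideanSpace ℝ (Fin 4)) (TangentSpace (𝓡 4) : M → Type _))
    [g.HasLeviCivita] (hg : g.IsRiemannian),
    ENNReal.ofReal Real.pi ≤ globalInjectivityRadius g →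
    (∀ x : M, 12 * (1 - ε) ≤ g.scalarCurvature x) →
    ∀ τ : ℝ, 0 < τ → τ ≤ (1 + η) / 8 →
      ClauseAt M g hg (Real.log 2 + Real.log Real.pi / 2 - 3 / 2 + δ) τ

/-- **[A] Transfer target `C⁺(Σ)`: almost-Wiedersehen metrics exist on homotopy 4-spheres.**
`inj ≥ π` (normalisation + no conjugate points / no short loops below π), `R ≥ 12(1−ε)` (98.7 % of Green's
bound), and ONE functional constant: log-Sobolev constant `≥ 4/(1+η)` for `dV/V`.  At `ε = η = 0` Green's
rigidity forces the round `S⁴`; the round metric satisfies it with `(inj, R, α) = (π, 12, 4)`.  SPC4-hard. -/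
def AlmostWiedersehenExistence (ε η : ℝ) : Prop :=
  ∀ (M : Type) [TopologicalSpace M] [T2Space M] [SecondCountableTopology M]
    [ChartedSpace (EuclideanSpace ℝ (Fin 4)) M] [IsManifold (𝓡 4) ∞ M] [CompactSpace M] [T3Space M]
    [MeasurableSpace M] [BorelSpace M],
    M ≃ₕ Metric.sphere (0 : EuclideanSpace ℝ (Fin 5)) 1 →
    ∃ g : PseudoRiemannianMetric (𝓡 4) ∞ (EuclideanSpace ℝ (Fin 4)) (TangentSpace (𝓡 4) : M → Type _),
    ∃ _ : g.HasLeviCivita, ∃ hg : g.IsRiemannian,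
      ENNReal.ofReal Real.pi ≤ globalInjectivityRadius g ∧
      (∀ x : M, 12 * (1 - ε) ≤ g.scalarCurvature x) ∧
      LSI M g hg (4 / (1 + η))

/-- **The reduction** (composition target of the line; proof = TopWindow + Berger + [B], then the crux's
`∃ δ` with `δ' = min δ (ν_rd + 2 log(1−ε) − ν_cyl)`; needs `0 ≤ ε < 0.01304`, `0 < η`, `0 < δ`, and
`M ≃ₕ S⁴ ⇒ M` connected): `[B] ∧ [A] ⇒ SubcylindricalExistence`. -/
def InjectivityWindowReduction : Prop :=
  ∀ ε η δ : ℝ, 0 ≤ ε → ε ≤ 0.0128 → 0 < η → 0 < δ →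
    BergerIsoembolicFour → TopWindow ε (4 / (1 + η)) →
    SubinjectivityBound ε η δ → AlmostWiedersehenExistence ε η → SubcylindricalExistence

/-- **Arithmetic behind the top window** (PROVED): with scalar-curvature slack `ε ≤ 0.0128` the
top-window level `ν_rd + 2 log(1−ε)` still clears `ν_cyl` — from the landed certificate
`Negative.margin_gt : 0.026 < ν_rd − ν_cyl` and `log(1−ε) ≥ 1 − 1/(1−ε) = −ε/(1−ε) ≥ −0.0128/0.9872 > −0.013`.
(The exact slack is `ε < 1 − (πe/9)^{1/4} = 0.01304…`.) -/
theorem slackWindow {ε : ℝ} (hε : ε ≤ 0.0128) :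
    Real.log 2 + Real.log Real.pi / 2 - 3 / 2 < Real.log 6 - 2 + 2 * Real.log (1 - ε) := by
  have hm := Summit.SmoothPoincare4.Cruxes.SubcylindricalExistence.Negative.margin_gt
  have hpos : (0 : ℝ) < 1 - ε := by linarith
  have hlog : 1 - (1 - ε)⁻¹ ≤ Real.log (1 - ε) := Real.one_sub_inv_le_log_of_pos hpos
  have hinv : (1 - ε)⁻¹ ≤ 1 / 0.9872 := by
    rw [inv_eq_one_div]
    apply div_le_div_of_nonneg_left (by norm_num) (by norm_num) (by linarith)
  have h013 : (-0.013 : ℝ) < 1 - (1 - ε)⁻¹ := by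
    have : (1 : ℝ) / 0.9872 < 1.013 := by norm_num
    linarith
  linarith

end Summit.SmoothPoincare4.SmoothPoincare4.Cruxes.SubcylindricalExistence.InjectivityWindow

end
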